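import Literature.MathematicalPhysics.QuantumFieldTheory.Balaban1983to89.Node00.TransportOfRecordGaugeFixing
import Literature.MathematicalPhysics.QuantumFieldTheory.Balaban1983to89.Node00.TkNoExpansionStepZero

/-!
# NODE 00 — GAUGE FIXING UNDER THE δ-FUNCTION, (†)-FAMILY EDITION: the Faddeev–Popov weight of [III] (1.5)⇒(1.6) ∕ p. 265 inside def-T's
# T-step `(𝐓e^A)_{k+1}(s')(V') = ∫dU δ(ŪV'⁻¹)[w(s')(U,V')·χ_k·T_k]`, whose integrand DEPENDS ON THE COARSE FIELD `V'`

HEADER — WORK-UNIT METADATA.  Cell `pub-ymgap`, YM-PLAN Track A (HUMAN RULING D-0062), R134 fan-out seat `pub-ymgap-dag-n11-e` (g22) on node N11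
[B14], strategy s3; route `BalabanUVNodes`, item K1⁷ `StabilityBAtRecordR13SepCoPH` = stmt-QuantumFields-20542 (helper, `--kind proof --supports 20542`,
count-neutral).  [I] = [Balaban1987RG1], [III] = [Balaban1988Convergent].  FILE 2 of this seat's g22 pair, over FILE 1 `Node00/TransportOfRecordGaugeFixing`
(★★ `kernelTransport_fpWeight_mul_ae_eq`: for a `V'`-FREE fine-gauge-invariant integrable density, `transportK Ū (fpW·ρ) =ᵐ transportK Ū ρ`) and 11a's
`Node00/TkNoExpansionStepZero` §3 (`transportK_congr_ae_of_fibre`: two `V'`-indexed integrand families agreeing ON THE GRAPH `V' = Ū` have a.e.-equal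
transports) — both BY NAME, unmodified; def-T's `Node00/TStepOfRecord` (`tstepOfRecord`, `tstepOfRecord_apply`, `integrable_graph_piece`).

WHY.  def-T's value-level T-step (†) `tstepOfRecord … k T s' V' = transportOfRecord k (U ↦ w(s')(U,V')·χ_k(init s')(U)·T(init s')(U)) V'` has an
integrand that READS `V'` through the step weights (the resummed (3.2)·(3.3)·(3.5)·(3.16)·(3.20) decompositions of unity are inserted at fixed `V_{k+1}`,
[III] p. 265).  FILE 1's law is stated for a fixed integrand; this file passes it through the graph: on the fibre `{Ū = V'}` the family `U ↦ I(U, V')` is the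
single density `U ↦ I(U, Ū U)`, which is fine-gauge invariant as soon as every `I(·, V')` is (the averaging is invariant under the fine gauge group), so the
Faddeev–Popov weight of (1.5)⇒(1.6) may be inserted under the δ-function of (†) exactly as print does at p. 265 L.10–12 — for `dV'`-a.e. `V'`, for every new
sequence `s'`, for fine-gauge-invariant weights, front factors and slots.

WHAT THIS FILE PROVES (0 `def`, 0 `sorry`, standard axioms).
§1 (generic `GaugeGroup G` with Haar data and standard Borel structure, standing range, any `cd : ContourData`, `α > 0`, `z ≠ 0`, any finset `Y` of centres;
   `avg` measurable, `HaarAC`, invariant under the fine gauge group): `fineGaugeInvariant_graph` (`U ↦ I(U, Ū U)` is fine-gauge invariant when every `I(·,V')` is) ·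
   ★★ `transportK_family_fpWeight_mul_ae_eq` (`(V' ↦ ∫dU δ(ŪV'⁻¹) fpW(U)·I(U,V')) =ᵐ (V' ↦ ∫dU δ(ŪV'⁻¹) I(U,V'))` under graph-side integrability of `U ↦ I(U, ŪU)`) ·
   `transportK_family_fpWeight_mul_ae_eq_of_piece` (the same with def-T's integrability shape: `I(U,V') = F(U)·b(V',U)`, `F` integrable, `b` bounded jointly measurable).
§1b ★★ `texpASucc_fpWeight_mul_weights_ae_eq` — def-T's GENERIC value-level T-step `texpASucc` (any `Seq D k`, any averaging): inserting the Faddeev–Popov weight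
   into the step weights changes (†) only on a `dV'`-null set.
§2 AT THE RECORD (`G = SU(N)`, run `p`, `k < p.K`, `cd := contourOfRecord F N p.K k`, `ε₀ > 0`): ★★ `transportOfRecord_family_fpWeight_mul_ae_eq` ·
   ★★★ `transportOfRecord_fpWeight_mul_tstepIntegrand_ae_eq_tstepOfRecord` — for step weights `w` with every `w(s')(·,V')` fine-gauge invariant, jointly measurable
   and bounded, fine-gauge-invariant front factor `χ_k(init s')` and slot `T(init s')` with `χ_k·T` integrable:
   `(V' ↦ transportOfRecord k (U ↦ fpW(U)·[w(s')(U,V')·χ_k(init s')(U)·T(init s')(U)]) V') =ᵐ[dV'] tstepOfRecord … k T s'` — (1.5)⇒(1.6) inserted under the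
   δ-function of def-T's (†), [III] p. 265 L.10–12 at the value level.

NOT IN THIS FILE: fine-gauge invariance OF RECORD of K0b's step weights ∕ def-R's front factors ∕ the represented tower's slots (their laws, displayed here as
hypotheses), the choice of `Y`, (3.6)–(3.9), the resummation into `ζ(Ω_{k+1})`, any chart.

HONEST FRAMING.  Helper lane of K1⁷, count-neutral; compositions BY NAME; nothing of Bałaban's ESTIMATES asserted; (B4) ∕ (S-α) ∕ (O3′) NOT closed; N11 NOT
discharged; K1⁷ NOT closed; counts unmoved (typed 28∕28 · discharged 5∕27).  One finite four-torus programme at fixed `ε = L^{−K}`; R4 closes only the conditional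
finite-𝕋⁴ rung `BalabanLadder.UV` — NOT ℝ⁴, NOT OS, NOT a mass gap, NOT Clay.  No `sorry`, `axiom`, `def`, `instance`, `notation`.  Sources (SHAPE ∕ bookkeeping
only): [III] (1.5)–(1.6) p.247, (3.1) p.264, p.265 L.10–12; [I] (0.13)–(0.16) pp.254–255.
-/

noncomputable section

open _root_.MeasureTheory _root_.Function
open scoped ENNReal BigOperators

namespace Literature.MathematicalPhysics.QuantumFieldTheory.Balaban1983to89.Node00

open T4Continuum (T4Family)
open GaugeField (gaugeAct)
open T4AveragingDisintegration (kernelTransport transportK)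
open B14.Eq218Concrete (Seq)
open T4FiniteEpsInhabited (HaarAC)
open B12FaddeevPopov016 (FineGauge FineGaugeInvariant fpIntegrand)

/-! ## §1  The (†)-family edition of the Faddeev–Popov weight under `δ(ŪV⁻¹)` -/

section Family

variable {P : Params} {j : ℕ} {G : Type*} [GaugeGroup G]

/-- ON THE GRAPH a fine-gauge-invariant family is ONE fine-gauge-invariant density: if every `I(·, V')` is invariant under the fine gauge group and the averaging
is, then so is `U ↦ I(U, Ū U)`. [cite: Balaban1987RG1, (0.13) p.254; Balaban1988Convergent, (3.1) p.264 (bookkeeping)] -/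
theorem fineGaugeInvariant_graph {avg : GaugeField P j G → GaugeField P (j + 1) G}
    (havgInv : ∀ u : GaugeTransf P j G, FineGauge u → ∀ U, avg (gaugeAct u U) = avg U)
    {I : GaugeField P j G → GaugeField P (j + 1) G → ℝ} (hI : ∀ V, FineGaugeInvariant (fun U => I U V)) :
    FineGaugeInvariant (fun U => I U (avg U)) := by
  intro u hu U
  simp only [havgInv u hu U]
  exact hI (avg U) u hu U

variable [MeasurableSpace G] [HaarData G] [RegularGaugeGroup G] [StandardBorelSpace G]

/-- ★★ **THE FADDEEV–POPOV WEIGHT UNDER THE δ-FUNCTION, FOR A `V'`-DEPENDENT INTEGRAND** ((†)-shape): for an averaging `Ū` (measurable, `HaarAC`, fine-gauge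
invariant), any contour data, any finset `Y` of centres, `α > 0`, `z ≠ 0`, and a family `I(U, V')` with every `I(·, V')` fine-gauge invariant and `U ↦ I(U, Ū U)`
integrable: `∫dU δ(ŪV'⁻¹) [Π_{y∈Y}Π_{x∈B(y)∖y}(1∕z)χ e^{−(1∕α)[1−Re tr U(y,x)]}] I(U,V') = ∫dU δ(ŪV'⁻¹) I(U,V')` for `dV'`-a.e. `V'` — FILE 1's law passed through the
graph by 11a's `transportK_congr_ae_of_fibre`. [cite: Balaban1988Convergent, (1.5)–(1.6) p.247, p.265 L.10–12, (3.1) p.264] -/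
theorem transportK_family_fpWeight_mul_ae_eq (hj : j + 1 ≤ P.m + P.K) (cd : ContourData P j G)
    (hcd : ∀ (y : Site P (j + 1)) (x : Site P j), Measurable fun U : GaugeField P j G => cd.holTo U y x)
    {α ε₀ : ℝ} (hα : 0 < α) (hz : B16ZLower.zNorm G α ε₀ ≠ 0) (Y : Finset (Site P (j + 1)))
    {avg : GaugeField P j G → GaugeField P (j + 1) G} (havg : Measurable avg) (hac : HaarAC avg)
    (havgInv : ∀ u : GaugeTransf P j G, FineGauge u → ∀ U, avg (gaugeAct u U) = avg U)
    {I : GaugeField P j G → GaugeField P (j + 1) G → ℝ} (hI : ∀ V, FineGaugeInvariant (fun U => I U V))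
    (hIg : Integrable (fun U => I U (avg U)) (fieldMeasure P j G)) :
    (fun V => transportK avg (fun U =>
        (∏ y ∈ Y, ∏ x ∈ (block y).erase (emb y), (B16ZLower.zNorm G α ε₀)⁻¹ * fpIntegrand α ε₀ (cd.holTo U y x)) * I U V) V)
      =ᵐ[fieldMeasure P (j + 1) G] fun V => transportK avg (fun U => I U V) V := by
  have h1 := transportK_congr_ae_of_fibre (P := P) (G := G) havg hac
    (f := fun V U => (∏ y ∈ Y, ∏ x ∈ (block y).erase (emb y),
      (B16ZLower.zNorm G α ε₀)⁻¹ * fpIntegrand α ε₀ (cd.holTo U y x)) * I U V)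
    (g := fun _ U => (∏ y ∈ Y, ∏ x ∈ (block y).erase (emb y),
      (B16ZLower.zNorm G α ε₀)⁻¹ * fpIntegrand α ε₀ (cd.holTo U y x)) * I U (avg U)) (fun _ => rfl)
  have h2 := transportK_congr_ae_of_fibre (P := P) (G := G) havg hac (f := fun V U => I U V) (g := fun _ U => I U (avg U))
    (fun _ => rfl)
  have h3 := kernelTransport_fpWeight_mul_ae_eq hj cd hcd hα hz Y havg hac havgInv (fineGaugeInvariant_graph havgInv hI) hIg
  exact h1.trans (h3.trans h2.symm)

/-- The same with def-T's integrability shape (`TStepOfRecord.integrable_graph_piece`): `I(U, V') = F(U)·b(V', U)` with `F` integrable and fine-gauge invariant,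
`b` bounded, jointly measurable and fine-gauge invariant in `U` for every `V'`. [cite: Balaban1988Convergent, (1.5)–(1.6) p.247, (3.1) p.264 (bookkeeping)] -/
theorem transportK_family_fpWeight_mul_ae_eq_of_piece (hj : j + 1 ≤ P.m + P.K) (cd : ContourData P j G)
    (hcd : ∀ (y : Site P (j + 1)) (x : Site P j), Measurable fun U : GaugeField P j G => cd.holTo U y x)
    {α ε₀ : ℝ} (hα : 0 < α) (hz : B16ZLower.zNorm G α ε₀ ≠ 0) (Y : Finset (Site P (j + 1)))
    {avg : GaugeField P j G → GaugeField P (j + 1) G} (havg : Measurable avg) (hac : HaarAC avg)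
    (havgInv : ∀ u : GaugeTransf P j G, FineGauge u → ∀ U, avg (gaugeAct u U) = avg U)
    {F : Density P j G} (hF : FineGaugeInvariant F) (hFi : Integrable F (fieldMeasure P j G))
    {b : GaugeField P (j + 1) G × GaugeField P j G → ℝ} (hb : Measurable b) {C : ℝ} (hbC : ∀ z, ‖b z‖ ≤ C)
    (hbinv : ∀ V, FineGaugeInvariant (fun U => b (V, U))) :
    (fun V => transportK avg (fun U =>
        (∏ y ∈ Y, ∏ x ∈ (block y).erase (emb y), (B16ZLower.zNorm G α ε₀)⁻¹ * fpIntegrand α ε₀ (cd.holTo U y x)) *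
          (F U * b (V, U))) V)
      =ᵐ[fieldMeasure P (j + 1) G] fun V => transportK avg (fun U => F U * b (V, U)) V :=
  transportK_family_fpWeight_mul_ae_eq hj cd hcd hα hz Y havg hac havgInv (I := fun U V => F U * b (V, U))
    (fun V u hu U => by simp only [hF u hu U, hbinv V u hu U]) (integrable_graph_piece havg hFi hb hbC)

end Family

/-! ## §1b  The same for def-T's GENERIC value-level T-step `texpASucc` (any sequences `Seq D k`, any averaging) -/

section TexpASucc

variable {P : Params} {k : ℕ} {G : Type*} [GaugeGroup G] [MeasurableSpace G] [HaarData G] [RegularGaugeGroup G] [StandardBorelSpace G]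
variable {ι : Type*} {D : ℕ → Set (Set ι)}

/-- ★★ **INSERTING THE FADDEEV–POPOV WEIGHT INTO THE STEP WEIGHTS CHANGES (†) ONLY ON A `dV'`-NULL SET**: for def-T's generic T-step
`texpASucc avg χk T w s' V' = ∫dU δ(ŪV'⁻¹)[w(s')(U,V')·χ_k(init s')(U)·T(init s')(U)]`, with every `w(s')(·,V')`, the front factor `χ_k(init s')` and the slot
`T(init s')` fine-gauge invariant and the graph-side integrand integrable,
`texpASucc avg χk T (s ↦ U ↦ V ↦ fpW(U)·w(s)(U,V)) s' =ᵐ[dV'] texpASucc avg χk T w s'` — [III] p. 265 L.10–12 «we introduce the axial gauge fixing as in (1.5) … We get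
an expansion of the form (1.6)» as a law about the value (†), whatever datum carries the gauge-fixing factors afterwards (the step weights, or 11a's `ζ` after
the resummation of p. 267). [cite: Balaban1988Convergent, (1.5)–(1.6) p.247, p.265 L.10–12, (3.1) p.264, (3.24)–(3.25) p.270] -/
theorem texpASucc_fpWeight_mul_weights_ae_eq (hk : k + 1 ≤ P.m + P.K) (cd : ContourData P k G)
    (hcd : ∀ (y : Site P (k + 1)) (x : Site P k), Measurable fun U : GaugeField P k G => cd.holTo U y x)
    {α ε₀ : ℝ} (hα : 0 < α) (hz : B16ZLower.zNorm G α ε₀ ≠ 0) (Y : Finset (Site P (k + 1)))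
    {avg : GaugeField P k G → GaugeField P (k + 1) G} (havg : Measurable avg) (hac : HaarAC avg)
    (havgInv : ∀ u : GaugeTransf P k G, FineGauge u → ∀ U, avg (gaugeAct u U) = avg U)
    (χk T : Seq D k → Density P k G) (w : Seq D (k + 1) → GaugeField P k G → GaugeField P (k + 1) G → ℝ) (s' : Seq D (k + 1))
    (hw : ∀ V', FineGaugeInvariant (fun U => w s' U V')) (hχ : FineGaugeInvariant (χk s'.init))
    (hT : FineGaugeInvariant (T s'.init))
    (hIg : Integrable (fun U => w s' U (avg U) * (χk s'.init U * T s'.init U)) (fieldMeasure P k G)) :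
    texpASucc avg χk T (fun s U V =>
        (∏ y ∈ Y, ∏ x ∈ (block y).erase (emb y), (B16ZLower.zNorm G α ε₀)⁻¹ * fpIntegrand α ε₀ (cd.holTo U y x)) * w s U V) s'
      =ᵐ[fieldMeasure P (k + 1) G] texpASucc avg χk T w s' := by
  have e1 : texpASucc avg χk T (fun s U V =>
        (∏ y ∈ Y, ∏ x ∈ (block y).erase (emb y), (B16ZLower.zNorm G α ε₀)⁻¹ * fpIntegrand α ε₀ (cd.holTo U y x)) * w s U V) s'
      = fun V' => transportK avg (fun U =>
        (∏ y ∈ Y, ∏ x ∈ (block y).erase (emb y), (B16ZLower.zNorm G α ε₀)⁻¹ * fpIntegrand α ε₀ (cd.holTo U y x)) *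
          (w s' U V' * (χk s'.init U * T s'.init U))) V' := by
    funext V'
    unfold texpASucc tstepIntegrand
    simp only [mul_assoc]
  have e2 : texpASucc avg χk T w s' = fun V' => transportK avg (fun U => w s' U V' * (χk s'.init U * T s'.init U)) V' := rfl
  rw [e1, e2]
  exact transportK_family_fpWeight_mul_ae_eq hk cd hcd hα hz Y havg hac havgInv
    (I := fun U V' => w s' U V' * (χk s'.init U * T s'.init U))
    (fun V' u hu U => by simp only [hw V' u hu U, hχ u hu U, hT u hu U]) hIg

end TexpASucc

/-! ## §2  AT THE RECORD: the Faddeev–Popov weight under the δ-function of def-T's T-step `tstepOfRecord` -/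

section Record

variable (F : T4Family) (N : ℕ) [NeZero N]

/-- The standing range from `k < K`. [folklore] -/
private theorem succ_le_m_add_K_of_lt' {K k : ℕ} (hk : k < K) : k + 1 ≤ (F.P K).m + (F.P K).K := by
  simp only [T4Family.P_K, T4Family.P_m]; omega

/-- ★★ **THE FADDEEV–POPOV WEIGHT UNDER THE δ-FUNCTION OF THE TRANSPORT OF RECORD, `V'`-DEPENDENT INTEGRAND**: for `k < K`, `α > 0`, `ε₀ > 0`, any finset `Y`
of centres and a family `I(U, V')` with every `I(·, V')` fine-gauge invariant and `U ↦ I(U, ŪU)` integrable,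
`(V' ↦ transportOfRecord k (fpW·I(·,V')) V') =ᵐ (V' ↦ transportOfRecord k (I(·,V')) V')`. [cite: Balaban1988Convergent, (1.5)–(1.6) p.247, p.265 L.10–12, (3.1) p.264] -/
theorem transportOfRecord_family_fpWeight_mul_ae_eq {K k : ℕ} (hk : k < K) {α ε₀ : ℝ} (hα : 0 < α) (hε : 0 < ε₀)
    (Y : Finset (Site (F.P K) (k + 1))) {I : GaugeField (F.P K) k (SU N) → GaugeField (F.P K) (k + 1) (SU N) → ℝ}
    (hI : ∀ V, FineGaugeInvariant (fun U => I U V))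
    (hIg : Integrable (fun U => I U ((avOfRecord F N K k).avg U)) (fieldMeasure (F.P K) k (SU N))) :
    (fun V => transportOfRecord F N K k (fun U =>
        (∏ y ∈ Y, ∏ x ∈ (block y).erase (emb y),
          (B16ZLower.zNorm (SU N) α ε₀)⁻¹ * fpIntegrand α ε₀ ((contourOfRecord F N K k).holTo U y x)) * I U V) V)
      =ᵐ[fieldMeasure (F.P K) (k + 1) (SU N)] fun V => transportOfRecord F N K k (fun U => I U V) V :=
  transportK_family_fpWeight_mul_ae_eq (succ_le_m_add_K_of_lt' F hk) (contourOfRecord F N K k)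
    (measurable_holTo_contourOfRecord F N K k) hα (B12FaddeevPopov016TwoLevel.zNorm_specialUnitaryGroup_pos hα hε).ne' Y
    (avOfRecord_measurable F N K k) (avOfRecord_haarAC F N K k hk) (fun _ hu U => avOfRecord_gaugeAct_of_fineGauge F N hk hu U) hI hIg

/-- ★★★ **(1.5)⇒(1.6) INSERTED UNDER THE δ-FUNCTION OF def-T's T-STEP (†)** ([III] p. 265 L.10–12 at the value level): for a run `p`, couplings `g`, step
`k < p.K`, step weights `w` with every `w(s')(·, V')` fine-gauge invariant, `(V', U) ↦ w(s')(U, V')` jointly measurable and bounded, a fine-gauge-invariant front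
factor `χ_k(init s')` and slot `T(init s')` with `χ_k·T` integrable, `α > 0`, `ε₀ > 0`, any finset `Y` of centres of `T^{(k+1)}`:
`(V' ↦ ∫dU δ(ŪV'⁻¹) [Π_{y∈Y}Π_{x∈B(y)∖y}(1∕z)χ e^{−(1∕α)[1−Re tr U(y,x)]}]·w(s')(U,V')·χ_k(init s')(U)·T(init s')(U)) =ᵐ[dV'] tstepOfRecord … k T s'`.
[cite: Balaban1988Convergent, (1.5)–(1.6) p.247, p.265 L.10–12, (3.1) p.264, (3.24)–(3.25) p.270] -/
theorem transportOfRecord_fpWeight_mul_tstepIntegrand_ae_eq_tstepOfRecord (ν : Stage7Numerics) (M : ℕ)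
    (w : StepWeightsOfRecord F N ν M) (p : B12.RunParams) (g : ℕ → ℝ) {k : ℕ} (hk : k < p.K)
    (T : SeqOfRecord F ν M g p.K k → Density (F.P p.K) k (SU N)) (s' : SeqOfRecord F ν M g p.K (k + 1))
    {α ε₀ : ℝ} (hα : 0 < α) (hε : 0 < ε₀) (Y : Finset (Site (F.P p.K) (k + 1)))
    (hwinv : ∀ V', FineGaugeInvariant (fun U => w p g k s' U V'))
    (hw : Measurable (fun z : GaugeField (F.P p.K) (k + 1) (SU N) × GaugeField (F.P p.K) k (SU N) => w p g k s' z.2 z.1))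
    {C : ℝ} (hwb : ∀ U V', |w p g k s' U V'| ≤ C)
    (hχ : FineGaugeInvariant (chiSeqOfRecord F N ν M g p.K k s'.init)) (hT : FineGaugeInvariant (T s'.init))
    (hTi : Integrable (fun U => chiSeqOfRecord F N ν M g p.K k s'.init U * T s'.init U) (fieldMeasure (F.P p.K) k (SU N))) :
    (fun V' => transportOfRecord F N p.K k (fun U =>
        (∏ y ∈ Y, ∏ x ∈ (block y).erase (emb y),
          (B16ZLower.zNorm (SU N) α ε₀)⁻¹ * fpIntegrand α ε₀ ((contourOfRecord F N p.K k).holTo U y x)) *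
          (w p g k s' U V' * (chiSeqOfRecord F N ν M g p.K k s'.init U * T s'.init U))) V')
      =ᵐ[fieldMeasure (F.P p.K) (k + 1) (SU N)] tstepOfRecord F N ν M w p g k T s' := by
  have hI : ∀ V', FineGaugeInvariant (fun U => w p g k s' U V' * (chiSeqOfRecord F N ν M g p.K k s'.init U * T s'.init U)) :=
    fun V' u hu U => by simp only [hwinv V' u hu U, hχ u hu U, hT u hu U]
  have hIg : Integrable (fun U => w p g k s' U ((avOfRecord F N p.K k).avg U) *
      (chiSeqOfRecord F N ν M g p.K k s'.init U * T s'.init U)) (fieldMeasure (F.P p.K) k (SU N)) := by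
    have h := integrable_graph_piece (avOfRecord_measurable F N p.K k) hTi hw (C := C)
      (fun z => by rw [Real.norm_eq_abs]; exact hwb z.2 z.1)
    exact h.congr (ae_of_all _ fun U => by simp only [mul_comm])
  exact transportOfRecord_family_fpWeight_mul_ae_eq F N hk hα hε Y hI hIg

end Record

end Literature.MathematicalPhysics.QuantumFieldTheory.Balaban1983to89.Node00

end
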